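import Literature.Analysis.FluidPDE.NewtonGradientPotential
import Literature.Analysis.FluidPDE.BiotSavartNewtonKernel
import Literature.Analysis.FluidPDE.TaoEnergyLocalisationPressure
import Literature.Analysis.UnboundedOperators.HeatKernel
import Literature.Analysis.FluidPDE.RieszPressureSpaceTimeLp
import HarnessLib

/-!
# `L³` and `L²` bounds for the gradient of the Newtonian potential of a source supported in a ball

Analysis/FluidPDE proof file (theorems only). For a continuous source `g` supported in the ball
`B̄(0, 2R)` of `ℝ³` the first-derivative potential

  `T_a g (x) = ∫ ∂_aΓ(x − y) g(y) dy`   (`newtonGradPotential a g x`, `Γ = −1/(4π|z|)`),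

the `a`-component of `∇(Γ ⋆ g)`, obeys the scale-correct bound

  `‖T_a g‖_{L³} ≤ ‖a‖ (6R ‖g‖_{L³} + (48π²)^{-1/3} R⁻¹ ‖g‖_{L¹})`

(near field `|x| < 4R`: `|∂_aΓ(x − y)| ≤ ‖a‖ (4π|x−y|²)⁻¹ 1_{|x−y|<6R}`, a kernel of `L¹` norm `6R‖a‖`,
and Young's inequality; far field `|x| ≥ 4R`: `|x − y| ≥ |x|/2`, so `|T_a g(x)| ≤ ‖a‖‖g‖₁/(π|x|²)`,
and `∫_{|x|≥4R} |x|⁻⁶ dx = π/(48R³)`), and `T_a g ∈ L²`. This is the corrector estimate behind the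
divergence-free truncation of an `L³` field (`DivFreeL3Approximation.lean`): cutting off at scale
`R` produces the source `g = u·∇χ_R`, for which `R‖g‖₃` and `R⁻¹‖g‖₁` are both controlled by the
`L³` mass of `u` in the annulus `R ≤ |x| ≤ 2R`.

* `enorm_newtonGradPotential_le_lintegral` — `‖T_a g(x)‖ ≤ ‖a‖ (4π)⁻¹ ∫ |g(y)| |x − y|⁻² dy`;
* `lintegral_kernel_eq_near`, `lintegral_kernel_le_far` — the near and far forms of that integral;
* `lintegral_mul_kernel_rpow_le`, `lintegral_rpow_lintegral_mul_kernel_le` — Young's inequality with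
  an `L¹` kernel in lower-integral (Jensen) form;
* `lintegral_ball_enorm_newtonGradPotential_rpow_three_le`,
  `lintegral_compl_enorm_newtonGradPotential_rpow_three_le`,
  `lintegral_enorm_newtonGradPotential_rpow_three_le`, `eLpNorm_three_newtonGradPotential_le` — the
  `L³` bounds;
* `memLp_three_newtonGradPotential`, `memLp_two_newtonGradPotential` — membership in `L³`, `L²`.

## Mathlib / tree search

Tree (all used): `newtonGradPotential` (`NewtonGradientPotential`), `norm_fderiv_newtonKernel`
(`NewtonKernel`), `nearProfile₂`, `farProfile`, `lintegral_nearProfile₁_norm_sq`,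
`lintegral_farProfile_norm_sq`, `nearProfile₂_eq_sq` (`TaoEnergyLocalisationPressure`),
`UnboundedOperators.eLpNorm_convolution_le_lintegral_enorm_mul` (Young with an `L¹` kernel,
`UnboundedOperators/HeatKernel`). `lean search 'newtonGradPotential.*eLpNorm|eLpNorm.*newtonGrad'`:
nothing (2026-08-15).

## References

* D. Gilbarg, N. S. Trudinger, *Elliptic Partial Differential Equations of Second Order* (2001),
  Lemma 4.1 with (4.9) (the first-derivative potential), Lemma 7.12 (potential estimates).
  [GilbargTrudinger2001]
* E. M. Stein, *Singular Integrals and Differentiability Properties of Functions* (1970), Ch. V §1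
  (Riesz potentials; here only the elementary near/far splitting at a fixed scale is used).
  [Stein1971]
-/

noncomputable section

open MeasureTheory TopologicalSpace Set Function Filter Topology Metric Real
open scoped ENNReal NNReal RealInnerProductSpace Convolution

namespace Literature.Analysis.FluidPDE

open ContinuousLinearMap (lsmul)

variable {g : EuclideanSpace ℝ (Fin 3) → ℝ} {R : ℝ}

/-! ### Pointwise bounds -/

/-- The kernel bound `‖∂_aΓ(z)‖ ≤ ‖a‖ (4π‖z‖²)⁻¹`, for every `z` (at `z = 0` the right-hand side is
the junk value `0⁻¹ = 0` of Lean and the left-hand side vanishes because `Γ` is not differentiable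
there — we avoid this by stating the bound for `z ≠ 0`). [folklore] -/
theorem norm_fderiv_newtonKernel_apply_le {z : EuclideanSpace ℝ (Fin 3)} (hz : z ≠ 0)
    (a : EuclideanSpace ℝ (Fin 3)) :
    ‖fderiv ℝ newtonKernel z a‖ ≤ ‖a‖ * (4 * π * ‖z‖ ^ 2)⁻¹ := by
  calc ‖fderiv ℝ newtonKernel z a‖ ≤ ‖fderiv ℝ newtonKernel z‖ * ‖a‖ := (fderiv ℝ newtonKernel z).le_opNorm a
    _ = ‖a‖ * (4 * π * ‖z‖ ^ 2)⁻¹ := by rw [norm_fderiv_newtonKernel hz, mul_comm]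

/-- **`‖T_a g(x)‖ ≤ ‖a‖ (4π)⁻¹ ∫ |g(y)| ‖x − y‖⁻² dy`** (lower-integral form; the singular point
`y = x` is a null set). [cite: GilbargTrudinger2001, Lemma 4.1 with (4.9)] -/
theorem enorm_newtonGradPotential_le_lintegral (a x : EuclideanSpace ℝ (Fin 3)) :
    ‖newtonGradPotential a g x‖ₑ ≤
      ‖a‖ₑ * ENNReal.ofReal (4 * π)⁻¹ *
        ∫⁻ y, ‖g y‖ₑ * ENNReal.ofReal ((‖x - y‖ ^ 2)⁻¹) := by
  rw [newtonGradPotential]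
  refine (enorm_integral_le_lintegral_enorm _).trans ?_
  have hae : ∀ᵐ y ∂(volume : Measure (EuclideanSpace ℝ (Fin 3))), y ≠ x := by
    rw [ae_iff]
    have : {y : EuclideanSpace ℝ (Fin 3) | ¬ y ≠ x} = {x} := by ext y; simp
    rw [this, measure_singleton]
  calc ∫⁻ y, ‖fderiv ℝ newtonKernel (x - y) a • g y‖ₑ
      ≤ ∫⁻ y, ‖a‖ₑ * ENNReal.ofReal (4 * π)⁻¹ * (‖g y‖ₑ * ENNReal.ofReal ((‖x - y‖ ^ 2)⁻¹)) := by
        refine lintegral_mono_ae (hae.mono fun y hy => ?_)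
        have hxy : x - y ≠ 0 := sub_ne_zero.2 (Ne.symm hy)
        rw [enorm_smul]
        have h1 : ‖fderiv ℝ newtonKernel (x - y) a‖ₑ ≤
            ‖a‖ₑ * ENNReal.ofReal (4 * π)⁻¹ * ENNReal.ofReal ((‖x - y‖ ^ 2)⁻¹) := by
          rw [← ofReal_norm, ← ofReal_norm, ← ENNReal.ofReal_mul (norm_nonneg _),
            ← ENNReal.ofReal_mul (by positivity)]
          refine ENNReal.ofReal_le_ofReal ?_
          calc ‖fderiv ℝ newtonKernel (x - y) a‖ ≤ ‖a‖ * (4 * π * ‖x - y‖ ^ 2)⁻¹ :=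
                norm_fderiv_newtonKernel_apply_le hxy a
            _ = ‖a‖ * (4 * π)⁻¹ * (‖x - y‖ ^ 2)⁻¹ := by rw [mul_inv, mul_assoc]
        calc ‖fderiv ℝ newtonKernel (x - y) a‖ₑ * ‖g y‖ₑ
            ≤ ‖a‖ₑ * ENNReal.ofReal (4 * π)⁻¹ * ENNReal.ofReal ((‖x - y‖ ^ 2)⁻¹) * ‖g y‖ₑ :=
              mul_le_mul' h1 le_rfl
          _ = _ := by ring
    _ = ‖a‖ₑ * ENNReal.ofReal (4 * π)⁻¹ * ∫⁻ y, ‖g y‖ₑ * ENNReal.ofReal ((‖x - y‖ ^ 2)⁻¹) := by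
        rw [lintegral_const_mul']
        exact ENNReal.mul_ne_top enorm_ne_top ENNReal.ofReal_ne_top

/-- **Near-field bound.** If `supp g ⊆ B̄(0, 2R)` and `‖x‖ < 4R` then on the support `‖x − y‖ < 6R`,
so `∫ |g(y)| ‖x−y‖⁻² dy = ∫ 1_{‖x−y‖<6R}‖x−y‖⁻² |g(y)| dy`, the convolution of `|g|` with the
integrable kernel `k_{6R}(z) = 1_{‖z‖<6R}‖z‖⁻²` (`nearProfile₂`). [folklore] -/
theorem lintegral_kernel_eq_near (hsupp : tsupport g ⊆ closedBall (0 : EuclideanSpace ℝ (Fin 3)) (2 * R))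
    {x : EuclideanSpace ℝ (Fin 3)} (hx : ‖x‖ < 4 * R) :
    ∫⁻ y, ‖g y‖ₑ * ENNReal.ofReal ((‖x - y‖ ^ 2)⁻¹) =
      ∫⁻ y, ‖g y‖ₑ * ENNReal.ofReal (nearProfile₂ (6 * R) ‖x - y‖) := by
  refine lintegral_congr fun y => ?_
  by_cases hy : y ∈ tsupport g
  · have hy' : ‖y‖ ≤ 2 * R := mem_closedBall_zero_iff.1 (hsupp hy)
    have hxy : ‖x - y‖ < 6 * R := by
      calc ‖x - y‖ ≤ ‖x‖ + ‖y‖ := norm_sub_le _ _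
        _ < 4 * R + 2 * R := by linarith
        _ = 6 * R := by ring
    unfold nearProfile₂
    rw [if_pos hxy]
  · rw [image_eq_zero_of_notMem_tsupport hy, enorm_zero, zero_mul, zero_mul]

/-- **Far-field bound.** If `supp g ⊆ B̄(0, 2R)`, `0 < R` and `4R ≤ ‖x‖` then `‖x − y‖ ≥ ‖x‖/2` on the
support, so `∫ |g(y)| ‖x−y‖⁻² dy ≤ 4 ‖x‖⁻² ∫ |g|`. [folklore] -/
theorem lintegral_kernel_le_far (hsupp : tsupport g ⊆ closedBall (0 : EuclideanSpace ℝ (Fin 3)) (2 * R))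
    (hR : 0 < R) {x : EuclideanSpace ℝ (Fin 3)} (hx : 4 * R ≤ ‖x‖) :
    ∫⁻ y, ‖g y‖ₑ * ENNReal.ofReal ((‖x - y‖ ^ 2)⁻¹) ≤
      ENNReal.ofReal (4 * (‖x‖ ^ 2)⁻¹) * ∫⁻ y, ‖g y‖ₑ := by
  have hx0 : 0 < ‖x‖ := by linarith
  calc ∫⁻ y, ‖g y‖ₑ * ENNReal.ofReal ((‖x - y‖ ^ 2)⁻¹)
      ≤ ∫⁻ y, ‖g y‖ₑ * ENNReal.ofReal (4 * (‖x‖ ^ 2)⁻¹) := by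
        refine lintegral_mono fun y => ?_
        by_cases hy : y ∈ tsupport g
        · have hy' : ‖y‖ ≤ 2 * R := mem_closedBall_zero_iff.1 (hsupp hy)
          have hxy : ‖x‖ / 2 ≤ ‖x - y‖ := by
            have h2 : ‖x‖ - ‖y‖ ≤ ‖x - y‖ := norm_sub_norm_le x y
            linarith
          refine mul_le_mul' le_rfl (ENNReal.ofReal_le_ofReal ?_)
          have h1 : (‖x‖ / 2) ^ 2 ≤ ‖x - y‖ ^ 2 := pow_le_pow_left₀ (by positivity) hxy 2
          have h2 : 0 < (‖x‖ / 2) ^ 2 := by positivity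
          calc (‖x - y‖ ^ 2)⁻¹ ≤ ((‖x‖ / 2) ^ 2)⁻¹ := inv_anti₀ h2 h1
            _ = 4 * (‖x‖ ^ 2)⁻¹ := by
                field_simp
                ring
        · rw [image_eq_zero_of_notMem_tsupport hy, enorm_zero, zero_mul, zero_mul]
    _ = ENNReal.ofReal (4 * (‖x‖ ^ 2)⁻¹) * ∫⁻ y, ‖g y‖ₑ := by
        rw [← lintegral_const_mul' _ _ ENNReal.ofReal_ne_top]
        exact lintegral_congr fun y => mul_comm _ _

/-! ### Young's inequality for an `L¹` kernel, lower-integral form -/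

/-- **Young's inequality with an `L¹` kernel (Jensen form), pointwise step.** For conjugate
exponents `p, q` and nonnegative measurable `G, k` on `ℝ³`,
`(∫ G(y) k(x − y) dy)^q ≤ (∫ k)^{q−1} ∫ k(x − y) G(y)^q dy` (Hölder with the weights `k^{1/p}`,
`k^{1/q} G`, and translation invariance). [folklore] -/
theorem lintegral_mul_kernel_rpow_le {p q : ℝ} (hpq : p.HolderConjugate q)
    {G k : EuclideanSpace ℝ (Fin 3) → ℝ≥0∞} (hG : Measurable G) (hk : Measurable k)
    (x : EuclideanSpace ℝ (Fin 3)) :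
    (∫⁻ y, G y * k (x - y)) ^ q ≤ (∫⁻ z, k z) ^ (q - 1) * ∫⁻ y, k (x - y) * G y ^ q := by
  have hp := hpq.lt
  have hq := hpq.symm.lt
  have hp0 := hpq.pos
  have hq0 := hpq.symm.pos
  have hkx : Measurable fun y => k (x - y) := hk.comp (measurable_const.sub measurable_id)
  -- Hölder with `A = k^{1/p}`, `B = k^{1/q} G`
  set A : EuclideanSpace ℝ (Fin 3) → ℝ≥0∞ := fun y => k (x - y) ^ (1 / p) with hA
  set B : EuclideanSpace ℝ (Fin 3) → ℝ≥0∞ := fun y => k (x - y) ^ (1 / q) * G y with hB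
  have hAm : AEMeasurable A volume := (hkx.pow_const _).aemeasurable
  have hBm : AEMeasurable B volume := ((hkx.pow_const _).mul hG).aemeasurable
  have hsplit : ∀ y, G y * k (x - y) = A y * B y := fun y => by
    simp only [hA, hB]
    rw [← mul_assoc, ← ENNReal.rpow_add_of_nonneg _ _ (by positivity) (by positivity),
      show 1 / p + 1 / q = 1 by rw [one_div, one_div]; exact hpq.inv_add_inv_eq_one,
      ENNReal.rpow_one, mul_comm]
  have hH := ENNReal.lintegral_mul_le_Lp_mul_Lq volume hpq hAm hBm
  have eA : ∫⁻ y, A y ^ p = ∫⁻ z, k z := by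
    have h1 : ∀ y, A y ^ p = k (x - y) := fun y => by
      simp only [hA]
      rw [← ENNReal.rpow_mul, one_div, inv_mul_cancel₀ hp0.ne', ENNReal.rpow_one]
    simp_rw [h1]
    exact lintegral_sub_left_eq_self k x
  have eB : ∫⁻ y, B y ^ q = ∫⁻ y, k (x - y) * G y ^ q := by
    refine lintegral_congr fun y => ?_
    simp only [hB]
    rw [ENNReal.mul_rpow_of_nonneg _ _ hq0.le, ← ENNReal.rpow_mul, one_div,
      inv_mul_cancel₀ hq0.ne', ENNReal.rpow_one]
  simp_rw [hsplit]
  rw [eA, eB] at hH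
  -- raise to the power `q`
  have h := ENNReal.rpow_le_rpow hH hq0.le
  refine h.trans (le_of_eq ?_)
  rw [ENNReal.mul_rpow_of_nonneg _ _ hq0.le, ← ENNReal.rpow_mul, ← ENNReal.rpow_mul, one_div,
    one_div, inv_mul_cancel₀ hq0.ne', ENNReal.rpow_one]
  congr 1
  have : p⁻¹ * q = q - 1 := by
    have h1 : p⁻¹ = 1 - q⁻¹ := by
      have := hpq.inv_add_inv_eq_one
      linarith
    rw [h1, sub_mul, one_mul, inv_mul_cancel₀ hq0.ne']
  rw [this]

/-- **Young's inequality with an `L¹` kernel, lower-integral form**: for conjugate `p, q`,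
`∫ (∫ G(y) k(x − y) dy)^q dx ≤ (∫ k)^q ∫ G^q` (Jensen form, then Tonelli and the translation
invariance of Lebesgue measure). [folklore] -/
theorem lintegral_rpow_lintegral_mul_kernel_le {p q : ℝ} (hpq : p.HolderConjugate q)
    {G k : EuclideanSpace ℝ (Fin 3) → ℝ≥0∞} (hG : Measurable G) (hk : Measurable k)
    (S : Set (EuclideanSpace ℝ (Fin 3))) :
    ∫⁻ x in S, (∫⁻ y, G y * k (x - y)) ^ q ≤ (∫⁻ z, k z) ^ q * ∫⁻ y, G y ^ q := by
  have hq0 := hpq.symm.pos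
  have hunc : Measurable (uncurry fun x y : EuclideanSpace ℝ (Fin 3) => k (x - y) * G y ^ q) :=
    (hk.comp (measurable_fst.sub measurable_snd)).mul ((hG.pow_const q).comp measurable_snd)
  have hFm : Measurable fun x : EuclideanSpace ℝ (Fin 3) => ∫⁻ y, k (x - y) * G y ^ q :=
    hunc.lintegral_prod_right'
  calc ∫⁻ x in S, (∫⁻ y, G y * k (x - y)) ^ q
      ≤ ∫⁻ x, (∫⁻ y, G y * k (x - y)) ^ q := setLIntegral_le_lintegral _ _
    _ ≤ ∫⁻ x, (∫⁻ z, k z) ^ (q - 1) * ∫⁻ y, k (x - y) * G y ^ q :=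
        lintegral_mono fun x => lintegral_mul_kernel_rpow_le hpq hG hk x
    _ = (∫⁻ z, k z) ^ (q - 1) * ∫⁻ x, ∫⁻ y, k (x - y) * G y ^ q :=
        lintegral_const_mul'' _ hFm.aemeasurable
    _ = (∫⁻ z, k z) ^ (q - 1) * ((∫⁻ z, k z) * ∫⁻ y, G y ^ q) := by
        congr 1
        rw [lintegral_lintegral_swap hunc.aemeasurable]
        calc ∫⁻ y, ∫⁻ x, k (x - y) * G y ^ q = ∫⁻ y, G y ^ q * ∫⁻ z, k z := by
              refine lintegral_congr fun y => ?_
              have hky : Measurable (fun x : EuclideanSpace ℝ (Fin 3) => k (x - y)) :=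
                hk.comp (measurable_id.sub_const y)
              rw [lintegral_mul_const _ hky, lintegral_sub_right_eq_self k y, mul_comm]
          _ = (∫⁻ z, k z) * ∫⁻ y, G y ^ q := by
              rw [lintegral_mul_const _ (hG.pow_const q), mul_comm]
    _ = (∫⁻ z, k z) ^ q * ∫⁻ y, G y ^ q := by
        rw [← mul_assoc]
        congr 1
        conv_rhs => rw [show q = (q - 1) + 1 by ring]
        rw [ENNReal.rpow_add_of_nonneg _ _ (by linarith [hpq.symm.lt]) zero_le_one, ENNReal.rpow_one]

/-! ### The near kernel `k_{6R}(z) = 1_{‖z‖<6R}‖z‖⁻²` and the far weight `1_{‖x‖≥4R}‖x‖⁻²` -/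

/-- `∫ 1_{‖z‖<r}‖z‖⁻² dz = 4πr` in `ℝ≥0∞`. [folklore] -/
theorem lintegral_nearProfile₂_norm {r : ℝ} (hr : 0 < r) :
    ∫⁻ z : EuclideanSpace ℝ (Fin 3), ENNReal.ofReal (nearProfile₂ r ‖z‖) = ENNReal.ofReal (4 * π * r) := by
  rw [← lintegral_nearProfile₁_norm_sq hr]
  refine lintegral_congr fun z => ?_
  rw [nearProfile₂_eq_sq, ENNReal.ofReal_pow (nearProfile₁_nonneg r (norm_nonneg z))]

/-- On `‖x‖ ≥ r > 0`: `(ofReal ‖x‖⁻²)³ = (ofReal (1_{r≤‖x‖}‖x‖⁻³))²`. [folklore] -/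
theorem ofReal_inv_sq_rpow_three_eq_farProfile_sq {r : ℝ} (hr : 0 < r) {x : EuclideanSpace ℝ (Fin 3)}
    (hx : r ≤ ‖x‖) :
    ENNReal.ofReal ((‖x‖ ^ 2)⁻¹) ^ (3 : ℝ) = ENNReal.ofReal (farProfile r ‖x‖) ^ 2 := by
  have hx0 : 0 < ‖x‖ := hr.trans_le hx
  unfold farProfile
  rw [if_pos hx, ENNReal.ofReal_rpow_of_nonneg (by positivity) (by norm_num),
    ← ENNReal.ofReal_pow (by positivity)]
  congr 1
  rw [show (3 : ℝ) = ((3 : ℕ) : ℝ) by norm_num, Real.rpow_natCast]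
  ring

/-- `∫_{‖x‖≥4R} (‖x‖⁻²)³ dx = 4π/(3 (4R)³) = π/(48 R³)`. [folklore] -/
theorem lintegral_far_weight_rpow_three (hR : 0 < R) :
    ∫⁻ x in {x : EuclideanSpace ℝ (Fin 3) | 4 * R ≤ ‖x‖}, ENNReal.ofReal ((‖x‖ ^ 2)⁻¹) ^ (3 : ℝ) =
      ENNReal.ofReal (4 * π / (3 * (4 * R) ^ 3)) := by
  have h4R : 0 < 4 * R := by positivity
  rw [← lintegral_farProfile_norm_sq h4R, ← lintegral_indicator (measurableSet_le measurable_const measurable_norm)]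
  refine lintegral_congr fun x => ?_
  by_cases hx : 4 * R ≤ ‖x‖
  · rw [indicator_of_mem (show x ∈ {x : EuclideanSpace ℝ (Fin 3) | 4 * R ≤ ‖x‖} from hx),
      ofReal_inv_sq_rpow_three_eq_farProfile_sq h4R hx]
  · rw [indicator_of_notMem (show x ∉ {x : EuclideanSpace ℝ (Fin 3) | 4 * R ≤ ‖x‖} from hx)]
    unfold farProfile
    rw [if_neg hx, ENNReal.ofReal_zero, zero_pow two_ne_zero]

/-- `∫_{‖x‖≥4R} (‖x‖⁻²)² dx < ∞` (`= π/R`; only finiteness is recorded, by polar coordinates and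
`∫_{4R}^∞ ρ⁻² dρ < ∞`). [folklore] -/
theorem lintegral_far_weight_sq_lt_top (hR : 0 < R) :
    ∫⁻ x in {x : EuclideanSpace ℝ (Fin 3) | 4 * R ≤ ‖x‖}, ENNReal.ofReal ((‖x‖ ^ 2)⁻¹) ^ 2 < ⊤ := by
  have h4R : 0 < 4 * R := by positivity
  -- the radial profile `f ρ = 1_{4R ≤ ρ} ρ⁻⁴`
  set f : ℝ → ℝ := fun ρ => if 4 * R ≤ ρ then (ρ ^ 4)⁻¹ else 0 with hf
  have hfm : Measurable f := Measurable.ite measurableSet_Ici ((measurable_id.pow_const 4).inv) measurable_const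
  have hf0 : ∀ ρ, 0 ≤ f ρ := fun ρ => by
    simp only [hf]; split_ifs <;> positivity
  have hint : Integrable fun x : EuclideanSpace ℝ (Fin 3) => f ‖x‖ := by
    rw [integrable_fun_norm_iff]
    have hg : IntegrableOn (fun ρ : ℝ => ρ ^ (-2 : ℝ)) (Ici (4 * R)) := by
      rw [integrableOn_Ici_iff_integrableOn_Ioi]
      exact integrableOn_Ioi_rpow_of_lt (by norm_num) h4R
    have hind : IntegrableOn ((Ici (4 * R)).indicator fun ρ : ℝ => ρ ^ (-2 : ℝ)) (Ioi 0) :=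
      ((integrable_indicator_iff measurableSet_Ici).2 hg).integrableOn
    refine hind.congr_fun (fun ρ hρ => ?_) measurableSet_Ioi
    have hρ0 : 0 < ρ := hρ
    simp only [hf]
    by_cases h : 4 * R ≤ ρ
    · rw [indicator_of_mem (mem_Ici.2 h), if_pos h,
        show (-2 : ℝ) = -((2 : ℕ) : ℝ) by norm_num, Real.rpow_neg hρ0.le, Real.rpow_natCast]
      field_simp
    · rw [indicator_of_notMem (fun h' => h (mem_Ici.1 h')), if_neg h, mul_zero]
  have hlt := hint.lintegral_lt_top
  rw [← lintegral_indicator (measurableSet_le measurable_const measurable_norm)]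
  refine lt_of_le_of_lt (lintegral_mono fun x => ?_) hlt
  by_cases hx : 4 * R ≤ ‖x‖
  · rw [indicator_of_mem (show x ∈ {x : EuclideanSpace ℝ (Fin 3) | 4 * R ≤ ‖x‖} from hx)]
    simp only [hf, if_pos hx]
    rw [← ENNReal.ofReal_pow (by positivity)]
    refine ENNReal.ofReal_le_ofReal (le_of_eq ?_)
    ring
  · rw [indicator_of_notMem (show x ∉ {x : EuclideanSpace ℝ (Fin 3) | 4 * R ≤ ‖x‖} from hx)]
    exact zero_le

/-! ### The `L³` and `L²` bounds -/

variable {a : EuclideanSpace ℝ (Fin 3)}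

/-- **Near part of the `L³` bound**: `∫_{‖x‖<4R} |T_a g|³ ≤ (6R‖a‖)³ ∫ |g|³` (Young's inequality with
the kernel `‖a‖(4π)⁻¹ 1_{‖z‖<6R}‖z‖⁻²` of `L¹` norm `6R‖a‖`). [cite: GilbargTrudinger2001, Lemma 4.1 with (4.9)] -/
theorem lintegral_ball_enorm_newtonGradPotential_rpow_three_le (hg : Continuous g)
    (hsupp : tsupport g ⊆ closedBall (0 : EuclideanSpace ℝ (Fin 3)) (2 * R)) (hR : 0 < R) :
    ∫⁻ x in {x : EuclideanSpace ℝ (Fin 3) | ‖x‖ < 4 * R}, ‖newtonGradPotential a g x‖ₑ ^ (3 : ℝ) ≤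
      (‖a‖ₑ * ENNReal.ofReal (6 * R)) ^ (3 : ℝ) * (∫⁻ y, ‖g y‖ₑ ^ (3 : ℝ)) := by
  set c : ℝ≥0∞ := ‖a‖ₑ * ENNReal.ofReal (4 * π)⁻¹ with hc
  have hc' : c ≠ ⊤ := ENNReal.mul_ne_top enorm_ne_top ENNReal.ofReal_ne_top
  set k : EuclideanSpace ℝ (Fin 3) → ℝ≥0∞ := fun z => ENNReal.ofReal (nearProfile₂ (6 * R) ‖z‖) with hk
  have hkm : Measurable k := measurable_ofReal_profile_norm (measurable_nearProfile₂ _)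
  have hGm : Measurable fun y => ‖g y‖ₑ := hg.measurable.enorm
  have hB : MeasurableSet {x : EuclideanSpace ℝ (Fin 3) | ‖x‖ < 4 * R} :=
    measurableSet_lt measurable_norm measurable_const
  -- pointwise on the ball: `‖T x‖ₑ ≤ c ∫ |g| k(x - ·)`
  have hpt : ∀ x ∈ {x : EuclideanSpace ℝ (Fin 3) | ‖x‖ < 4 * R},
      ‖newtonGradPotential a g x‖ₑ ^ (3 : ℝ) ≤ c ^ (3 : ℝ) * (∫⁻ y, ‖g y‖ₑ * k (x - y)) ^ (3 : ℝ) := by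
    intro x hx
    have h := enorm_newtonGradPotential_le_lintegral a x (g := g)
    rw [lintegral_kernel_eq_near hsupp hx] at h
    calc ‖newtonGradPotential a g x‖ₑ ^ (3 : ℝ) ≤ (c * ∫⁻ y, ‖g y‖ₑ * k (x - y)) ^ (3 : ℝ) :=
          ENNReal.rpow_le_rpow h (by norm_num)
      _ = _ := ENNReal.mul_rpow_of_nonneg _ _ (by norm_num)
  have hpq : (3 / 2 : ℝ).HolderConjugate 3 := Real.holderConjugate_iff.2 ⟨by norm_num, by norm_num⟩
  have hY := lintegral_rpow_lintegral_mul_kernel_le hpq hGm hkm {x : EuclideanSpace ℝ (Fin 3) | ‖x‖ < 4 * R}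
  have hk1 : ∫⁻ z, k z = ENNReal.ofReal (4 * π * (6 * R)) := lintegral_nearProfile₂_norm (by positivity)
  calc ∫⁻ x in {x : EuclideanSpace ℝ (Fin 3) | ‖x‖ < 4 * R}, ‖newtonGradPotential a g x‖ₑ ^ (3 : ℝ)
      ≤ ∫⁻ x in {x : EuclideanSpace ℝ (Fin 3) | ‖x‖ < 4 * R},
          c ^ (3 : ℝ) * (∫⁻ y, ‖g y‖ₑ * k (x - y)) ^ (3 : ℝ) := setLIntegral_mono' hB hpt
    _ = c ^ (3 : ℝ) * ∫⁻ x in {x : EuclideanSpace ℝ (Fin 3) | ‖x‖ < 4 * R},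
          (∫⁻ y, ‖g y‖ₑ * k (x - y)) ^ (3 : ℝ) :=
        lintegral_const_mul' _ _ (ENNReal.rpow_ne_top_of_nonneg (by norm_num) hc')
    _ ≤ c ^ (3 : ℝ) * ((∫⁻ z, k z) ^ (3 : ℝ) * ∫⁻ y, ‖g y‖ₑ ^ (3 : ℝ)) := mul_le_mul' le_rfl hY
    _ = (‖a‖ₑ * ENNReal.ofReal (6 * R)) ^ (3 : ℝ) * ∫⁻ y, ‖g y‖ₑ ^ (3 : ℝ) := by
        rw [← mul_assoc, ← ENNReal.mul_rpow_of_nonneg _ _ (by norm_num), hk1, hc, mul_assoc,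
          ← ENNReal.ofReal_mul (by positivity)]
        congr 3
        field_simp

/-- **Far part of the `L³` bound**:
`∫_{‖x‖≥4R} |T_a g|³ ≤ (‖a‖ π⁻¹ ‖g‖₁)³ · 4π/(3(4R)³)` (`|T_a g(x)| ≤ ‖a‖‖g‖₁/(π|x|²)` there).
[cite: GilbargTrudinger2001, Lemma 4.1 with (4.9)] -/
theorem lintegral_compl_enorm_newtonGradPotential_rpow_three_le
    (hsupp : tsupport g ⊆ closedBall (0 : EuclideanSpace ℝ (Fin 3)) (2 * R)) (hR : 0 < R) :
    ∫⁻ x in {x : EuclideanSpace ℝ (Fin 3) | 4 * R ≤ ‖x‖}, ‖newtonGradPotential a g x‖ₑ ^ (3 : ℝ) ≤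
      (‖a‖ₑ * ENNReal.ofReal π⁻¹ * ∫⁻ y, ‖g y‖ₑ) ^ (3 : ℝ) *
        ENNReal.ofReal (4 * π / (3 * (4 * R) ^ 3)) := by
  set c : ℝ≥0∞ := ‖a‖ₑ * ENNReal.ofReal (4 * π)⁻¹ with hc
  set L : ℝ≥0∞ := ∫⁻ y, ‖g y‖ₑ with hL
  have hB : MeasurableSet {x : EuclideanSpace ℝ (Fin 3) | 4 * R ≤ ‖x‖} :=
    measurableSet_le measurable_const measurable_norm
  have hpt : ∀ x ∈ {x : EuclideanSpace ℝ (Fin 3) | 4 * R ≤ ‖x‖},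
      ‖newtonGradPotential a g x‖ₑ ^ (3 : ℝ) ≤
        (c * ENNReal.ofReal 4 * L) ^ (3 : ℝ) * ENNReal.ofReal ((‖x‖ ^ 2)⁻¹) ^ (3 : ℝ) := by
    intro x hx
    have h := (enorm_newtonGradPotential_le_lintegral a x (g := g)).trans
      (mul_le_mul' le_rfl (lintegral_kernel_le_far hsupp hR hx))
    rw [← ENNReal.mul_rpow_of_nonneg _ _ (by norm_num)]
    refine ENNReal.rpow_le_rpow (h.trans (le_of_eq ?_)) (by norm_num)
    rw [ENNReal.ofReal_mul (by norm_num)]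
    ring
  calc ∫⁻ x in {x : EuclideanSpace ℝ (Fin 3) | 4 * R ≤ ‖x‖}, ‖newtonGradPotential a g x‖ₑ ^ (3 : ℝ)
      ≤ ∫⁻ x in {x : EuclideanSpace ℝ (Fin 3) | 4 * R ≤ ‖x‖},
          (c * ENNReal.ofReal 4 * L) ^ (3 : ℝ) * ENNReal.ofReal ((‖x‖ ^ 2)⁻¹) ^ (3 : ℝ) :=
        setLIntegral_mono' hB hpt
    _ = (c * ENNReal.ofReal 4 * L) ^ (3 : ℝ) * ENNReal.ofReal (4 * π / (3 * (4 * R) ^ 3)) := by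
        rw [← lintegral_far_weight_rpow_three hR]
        by_cases htop : (c * ENNReal.ofReal 4 * L) ^ (3 : ℝ) = ⊤
        · -- degenerate: `L = ∞`; both sides are `⊤ * (positive)`
          have hpos : ∫⁻ x in {x : EuclideanSpace ℝ (Fin 3) | 4 * R ≤ ‖x‖},
              ENNReal.ofReal ((‖x‖ ^ 2)⁻¹) ^ (3 : ℝ) ≠ 0 := by
            rw [lintegral_far_weight_rpow_three hR]
            exact (ENNReal.ofReal_pos.2 (by positivity)).ne'
          rw [htop, ENNReal.top_mul hpos, lintegral_const_mul'' _ ?_]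
          · rw [ENNReal.top_mul hpos]
          · exact ((ENNReal.measurable_ofReal.comp ((measurable_norm.pow_const 2).inv)).pow_const _).aemeasurable
        · exact lintegral_const_mul' _ _ htop
    _ = (‖a‖ₑ * ENNReal.ofReal π⁻¹ * L) ^ (3 : ℝ) * ENNReal.ofReal (4 * π / (3 * (4 * R) ^ 3)) := by
        rw [hc, mul_assoc ‖a‖ₑ, ← ENNReal.ofReal_mul (by positivity)]
        congr 4
        field_simp

/-- **The `L³` bound**: `∫ |T_a g|³ ≤ (6R‖a‖)³ ∫|g|³ + (‖a‖‖g‖₁/π)³ · 4π/(3(4R)³)`.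
[cite: GilbargTrudinger2001, Lemma 4.1 with (4.9)] -/
theorem lintegral_enorm_newtonGradPotential_rpow_three_le (hg : Continuous g)
    (hsupp : tsupport g ⊆ closedBall (0 : EuclideanSpace ℝ (Fin 3)) (2 * R)) (hR : 0 < R) :
    ∫⁻ x, ‖newtonGradPotential a g x‖ₑ ^ (3 : ℝ) ≤
      (‖a‖ₑ * ENNReal.ofReal (6 * R)) ^ (3 : ℝ) * (∫⁻ y, ‖g y‖ₑ ^ (3 : ℝ)) +
        (‖a‖ₑ * ENNReal.ofReal π⁻¹ * ∫⁻ y, ‖g y‖ₑ) ^ (3 : ℝ) *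
          ENNReal.ofReal (4 * π / (3 * (4 * R) ^ 3)) := by
  have hB : MeasurableSet {x : EuclideanSpace ℝ (Fin 3) | ‖x‖ < 4 * R} :=
    measurableSet_lt measurable_norm measurable_const
  have hcompl : {x : EuclideanSpace ℝ (Fin 3) | ‖x‖ < 4 * R}ᶜ = {x | 4 * R ≤ ‖x‖} := by
    ext x; simp [not_lt]
  rw [← lintegral_add_compl _ hB, hcompl]
  exact add_le_add (lintegral_ball_enorm_newtonGradPotential_rpow_three_le hg hsupp hR)
    (lintegral_compl_enorm_newtonGradPotential_rpow_three_le hsupp hR)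

/-- **The `L³` bound in norm form**:
`‖T_a g‖_{L³} ≤ 6R‖a‖ ‖g‖_{L³} + ‖a‖π⁻¹ (4π/(3(4R)³))^{1/3} ‖g‖_{L¹}`.
[cite: GilbargTrudinger2001, Lemma 4.1 with (4.9)] -/
theorem eLpNorm_three_newtonGradPotential_le (hg : Continuous g)
    (hsupp : tsupport g ⊆ closedBall (0 : EuclideanSpace ℝ (Fin 3)) (2 * R)) (hR : 0 < R) :
    eLpNorm (newtonGradPotential a g) 3 volume ≤
      ‖a‖ₑ * ENNReal.ofReal (6 * R) * eLpNorm g 3 volume +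
        ‖a‖ₑ * ENNReal.ofReal π⁻¹ * (∫⁻ y, ‖g y‖ₑ) *
          ENNReal.ofReal (4 * π / (3 * (4 * R) ^ 3)) ^ (1 / 3 : ℝ) := by
  have h := lintegral_enorm_newtonGradPotential_rpow_three_le (a := a) hg hsupp hR
  have h3 : (3 : ℝ≥0∞) = ENNReal.ofReal 3 := by norm_num
  rw [lintegral_enorm_rpow_three_eq_eLpNorm_rpow, lintegral_enorm_rpow_three_eq_eLpNorm_rpow] at h
  have h' := ENNReal.rpow_le_rpow h (by norm_num : (0 : ℝ) ≤ 1 / 3)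
  rw [← ENNReal.rpow_mul, show (3 : ℝ) * (1 / 3) = 1 by norm_num, ENNReal.rpow_one] at h'
  refine h'.trans ((ENNReal.rpow_add_le_add_rpow _ _ (by norm_num) (by norm_num)).trans (le_of_eq ?_))
  rw [ENNReal.mul_rpow_of_nonneg _ _ (by norm_num), ← ENNReal.rpow_mul, ← ENNReal.rpow_mul,
    show (3 : ℝ) * (1 / 3) = 1 by norm_num, ENNReal.rpow_one, ENNReal.rpow_one,
    ENNReal.mul_rpow_of_nonneg _ _ (by norm_num), ← ENNReal.rpow_mul,
    show (3 : ℝ) * (1 / 3) = 1 by norm_num, ENNReal.rpow_one]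

/-- **`T_a g ∈ L³`** for a continuous `g` supported in `B̄(0, 2R)` (given the measurability of
`T_a g`, e.g. from its continuity). [folklore] -/
theorem memLp_three_newtonGradPotential (hg : Continuous g)
    (hsupp : tsupport g ⊆ closedBall (0 : EuclideanSpace ℝ (Fin 3)) (2 * R)) (hR : 0 < R)
    (hTm : AEStronglyMeasurable (newtonGradPotential a g) volume) :
    MemLp (newtonGradPotential a g) 3 volume := by
  have hgc : HasCompactSupport g := HasCompactSupport.of_support_subset_isCompact
    (isCompact_closedBall 0 (2 * R)) (subset_tsupport g |>.trans hsupp)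
  have hg3 : MemLp g 3 volume := hg.memLp_of_hasCompactSupport hgc
  have hg1 : ∫⁻ y, ‖g y‖ₑ < ⊤ := (hg.integrable_of_hasCompactSupport hgc).2
  refine ⟨hTm, lt_of_le_of_lt (eLpNorm_three_newtonGradPotential_le hg hsupp hR) ?_⟩
  refine ENNReal.add_lt_top.2 ⟨?_, ?_⟩
  · exact ENNReal.mul_lt_top (ENNReal.mul_lt_top enorm_lt_top ENNReal.ofReal_lt_top) hg3.2
  · exact ENNReal.mul_lt_top (ENNReal.mul_lt_top (ENNReal.mul_lt_top enorm_lt_top ENNReal.ofReal_lt_top)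
      hg1) (ENNReal.rpow_lt_top_of_nonneg (by norm_num) ENNReal.ofReal_ne_top)

/-- **`T_a g ∈ L²`** for a continuous `g` supported in `B̄(0, 2R)` (near part by Young with the same
`L¹` kernel, far part `≲ ‖g‖₁ |x|⁻² ∈ L²(|x| ≥ 4R)`). [folklore] -/
theorem memLp_two_newtonGradPotential (hg : Continuous g)
    (hsupp : tsupport g ⊆ closedBall (0 : EuclideanSpace ℝ (Fin 3)) (2 * R)) (hR : 0 < R)
    (hTm : AEStronglyMeasurable (newtonGradPotential a g) volume) :
    MemLp (newtonGradPotential a g) 2 volume := by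
  have hgc : HasCompactSupport g := HasCompactSupport.of_support_subset_isCompact
    (isCompact_closedBall 0 (2 * R)) (subset_tsupport g |>.trans hsupp)
  have hg2 : MemLp g 2 volume := hg.memLp_of_hasCompactSupport hgc
  have hg1 : ∫⁻ y, ‖g y‖ₑ < ⊤ := (hg.integrable_of_hasCompactSupport hgc).2
  set c : ℝ≥0∞ := ‖a‖ₑ * ENNReal.ofReal (4 * π)⁻¹ with hc
  have hc' : c ≠ ⊤ := ENNReal.mul_ne_top enorm_ne_top ENNReal.ofReal_ne_top
  set k : EuclideanSpace ℝ (Fin 3) → ℝ≥0∞ := fun z => ENNReal.ofReal (nearProfile₂ (6 * R) ‖z‖) with hk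
  have hkm : Measurable k := measurable_ofReal_profile_norm (measurable_nearProfile₂ _)
  have hGm : Measurable fun y => ‖g y‖ₑ := hg.measurable.enorm
  set L : ℝ≥0∞ := ∫⁻ y, ‖g y‖ₑ with hL
  have hB : MeasurableSet {x : EuclideanSpace ℝ (Fin 3) | ‖x‖ < 4 * R} :=
    measurableSet_lt measurable_norm measurable_const
  have hB' : MeasurableSet {x : EuclideanSpace ℝ (Fin 3) | 4 * R ≤ ‖x‖} :=
    measurableSet_le measurable_const measurable_norm
  have hcompl : {x : EuclideanSpace ℝ (Fin 3) | ‖x‖ < 4 * R}ᶜ = {x | 4 * R ≤ ‖x‖} := by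
    ext x; simp [not_lt]
  refine ⟨hTm, ?_⟩
  rw [eLpNorm_lt_top_iff_lintegral_rpow_enorm_lt_top two_ne_zero ENNReal.ofNat_ne_top,
    ENNReal.toReal_ofNat, ← lintegral_add_compl _ hB, hcompl]
  refine ENNReal.add_lt_top.2 ⟨?_, ?_⟩
  · -- near part: Young with `p = q = 2`
    have hpt : ∀ x ∈ {x : EuclideanSpace ℝ (Fin 3) | ‖x‖ < 4 * R},
        ‖newtonGradPotential a g x‖ₑ ^ (2 : ℝ) ≤ c ^ (2 : ℝ) * (∫⁻ y, ‖g y‖ₑ * k (x - y)) ^ (2 : ℝ) := by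
      intro x hx
      have h := enorm_newtonGradPotential_le_lintegral a x (g := g)
      rw [lintegral_kernel_eq_near hsupp hx] at h
      calc ‖newtonGradPotential a g x‖ₑ ^ (2 : ℝ) ≤ (c * ∫⁻ y, ‖g y‖ₑ * k (x - y)) ^ (2 : ℝ) :=
            ENNReal.rpow_le_rpow h (by norm_num)
        _ = _ := ENNReal.mul_rpow_of_nonneg _ _ (by norm_num)
    have hY := lintegral_rpow_lintegral_mul_kernel_le Real.HolderConjugate.two_two hGm hkm
      {x : EuclideanSpace ℝ (Fin 3) | ‖x‖ < 4 * R}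
    have hk1 : ∫⁻ z, k z = ENNReal.ofReal (4 * π * (6 * R)) := lintegral_nearProfile₂_norm (by positivity)
    have hg2' : ∫⁻ y, ‖g y‖ₑ ^ (2 : ℝ) < ⊤ := by
      have := hg2.2
      rw [eLpNorm_lt_top_iff_lintegral_rpow_enorm_lt_top two_ne_zero ENNReal.ofNat_ne_top,
        ENNReal.toReal_ofNat] at this
      exact this
    calc ∫⁻ x in {x : EuclideanSpace ℝ (Fin 3) | ‖x‖ < 4 * R}, ‖newtonGradPotential a g x‖ₑ ^ (2 : ℝ)
        ≤ ∫⁻ x in {x : EuclideanSpace ℝ (Fin 3) | ‖x‖ < 4 * R},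
            c ^ (2 : ℝ) * (∫⁻ y, ‖g y‖ₑ * k (x - y)) ^ (2 : ℝ) := setLIntegral_mono' hB hpt
      _ = c ^ (2 : ℝ) * ∫⁻ x in {x : EuclideanSpace ℝ (Fin 3) | ‖x‖ < 4 * R},
            (∫⁻ y, ‖g y‖ₑ * k (x - y)) ^ (2 : ℝ) :=
          lintegral_const_mul' _ _ (ENNReal.rpow_ne_top_of_nonneg (by norm_num) hc')
      _ ≤ c ^ (2 : ℝ) * ((∫⁻ z, k z) ^ (2 : ℝ) * ∫⁻ y, ‖g y‖ₑ ^ (2 : ℝ)) := mul_le_mul' le_rfl hY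
      _ < ⊤ := by
          rw [hk1]
          exact ENNReal.mul_lt_top (ENNReal.rpow_lt_top_of_nonneg (by norm_num) hc')
            (ENNReal.mul_lt_top (ENNReal.rpow_lt_top_of_nonneg (by norm_num) ENNReal.ofReal_ne_top) hg2')
  · -- far part
    have hpt : ∀ x ∈ {x : EuclideanSpace ℝ (Fin 3) | 4 * R ≤ ‖x‖},
        ‖newtonGradPotential a g x‖ₑ ^ (2 : ℝ) ≤
          (c * ENNReal.ofReal 4 * L) ^ (2 : ℝ) * ENNReal.ofReal ((‖x‖ ^ 2)⁻¹) ^ 2 := by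
      intro x hx
      have h := (enorm_newtonGradPotential_le_lintegral a x (g := g)).trans
        (mul_le_mul' le_rfl (lintegral_kernel_le_far hsupp hR hx))
      rw [← ENNReal.rpow_two, ← ENNReal.mul_rpow_of_nonneg _ _ (by norm_num)]
      refine ENNReal.rpow_le_rpow (h.trans (le_of_eq ?_)) (by norm_num)
      rw [ENNReal.ofReal_mul (by norm_num)]
      ring
    have hL : (c * ENNReal.ofReal 4 * L) ^ (2 : ℝ) ≠ ⊤ :=
      ENNReal.rpow_ne_top_of_nonneg (by norm_num)
        (ENNReal.mul_ne_top (ENNReal.mul_ne_top hc' ENNReal.ofReal_ne_top) hg1.ne)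
    calc ∫⁻ x in {x : EuclideanSpace ℝ (Fin 3) | 4 * R ≤ ‖x‖}, ‖newtonGradPotential a g x‖ₑ ^ (2 : ℝ)
        ≤ ∫⁻ x in {x : EuclideanSpace ℝ (Fin 3) | 4 * R ≤ ‖x‖},
            (c * ENNReal.ofReal 4 * L) ^ (2 : ℝ) * ENNReal.ofReal ((‖x‖ ^ 2)⁻¹) ^ 2 :=
          setLIntegral_mono' hB' hpt
      _ = (c * ENNReal.ofReal 4 * L) ^ (2 : ℝ) *
            ∫⁻ x in {x : EuclideanSpace ℝ (Fin 3) | 4 * R ≤ ‖x‖}, ENNReal.ofReal ((‖x‖ ^ 2)⁻¹) ^ 2 :=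
          lintegral_const_mul' _ _ hL
      _ < ⊤ := ENNReal.mul_lt_top hL.lt_top (lintegral_far_weight_sq_lt_top hR)

end Literature.Analysis.FluidPDE

end
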